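import Mathlib
import Summits.CriticalPhenomena.CardyFormulaZ2.Theorems.CardySelfRefinementDefs
import Literature.Probability.Percolation.QuadCrossingSpace
import Literature.Topology.PlaneTopology.CrosscutProofs
import HarnessLib

/-!
# Boundary-layer surgery, topology brick (S3), part I: trimming a crossing along a cut

Helper file of the registered stub `stub_layerLocalModification` (the deterministic
boundary-layer surgery) of the line `monotone-product-coordinates` (crux
`stmt-CriticalPhenomena-10269`, `…Theses.CardySelfRefinement.GradientComparability`).  Step (S3)
of the layer surgery ("dead fingers", file `…StubLayerDeadFinger.lean`) cuts the open quad
`[Q]°` by a cross-cut `β` through an interior point `m` of the segment of a lattice edge `e`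
and discards the part of a crossing inside the pocket cut off by `β`.  This file contains the
configuration-free plane topology of that step:

* `isPreconnected_inter_of_subsingleton` — two closed pieces of a connected set glued at no
  more than one point are connected;
* `isCrossing_trim` — a crossing `K ⊆ X ∪ [q, q']` of a quad meeting `β` at most at the interior
  point `m` of `[q, q']`, with `[Q] ⊆ cl₁ ∪ cl₂`, `cl₁ ∩ cl₂ ⊆ β`, `∂₀Q ∪ ∂₂Q` off `cl₁` and the
  `q`-half of the segment off `cl₂`, contains the crossing `K ∩ cl₂ ∩ X` of `Q` inside `X`;
* `segment_inter_subset_of_side` — the `q`-half `[q, m)` of the segment misses `cl₂` as soon as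
  the `q`-side half-ball at `m` lies in `U₁ ⊆ cl₁`;
* `crosscut_closure_cover` (registered helper) — for Newman's two sides `U₁, U₂` of a cross-cut
  `L` of a Jordan domain `J`: `closure J ⊆ cl U₁ ∪ cl U₂` and `cl U₁ ∩ cl U₂ ⊆ L`.

No percolation, no named fact.
-/

noncomputable section

namespace Summit.CriticalPhenomena.CardyFormulaZ2.Theorems.CardySelfRefinement

open scoped Topology
open Filter Set MeasureTheory
open Literature.Probability.LatticeModels Literature.Probability.Percolation
open Literature.Probability.Percolation.QuadCrossing
open Summit.CriticalPhenomena.CardyFormulaZ2.Theses.CardySelfRefinement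
open Literature.Topology.PlaneTopology Literature.Probability.RandomPlanarGeometry

variable {D : Set ℂ} {δ : ℝ}

/-! ## Two pieces of plane topology -/

/-- **Two closed pieces of a connected set glued at no more than one point are connected.**
If the preconnected `K` is covered by the closed sets `A`, `B` and `K ∩ A ∩ B` has at most one
point, then `K ∩ A` is preconnected. -/
theorem isPreconnected_inter_of_subsingleton {K A B : Set ℂ} (hK : IsPreconnected K)
    (hKAB : K ⊆ A ∪ B) (hA : IsClosed A) (hB : IsClosed B)
    (hAB : (K ∩ A ∩ B).Subsingleton) : IsPreconnected (K ∩ A) := by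
  rw [isPreconnected_closed_iff] at hK ⊢
  intro C C' hC hC' hcov hxC hyC'
  by_contra hempty
  rw [Set.not_nonempty_iff_eq_empty] at hempty
  -- if the common point (if any) of the two pieces lies in `E`, split `K` by the closed sets
  -- `(A ∩ E) ∪ B` and `A ∩ E'`
  have key : ∀ {E E' : Set ℂ}, IsClosed E → IsClosed E' → K ∩ A ⊆ E ∪ E' →
      (K ∩ A ∩ E).Nonempty → (K ∩ A ∩ E').Nonempty → K ∩ A ∩ (E ∩ E') = ∅ →
      (∀ z ∈ K ∩ A ∩ B, z ∈ E) → False := by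
    intro E E' hE hE' hcov hne hne' hempty hBE
    have h1 : K ⊆ (A ∩ E ∪ B) ∪ (A ∩ E') := by
      intro z hz
      rcases hKAB hz with hzA | hzB
      · rcases hcov ⟨hz, hzA⟩ with h | h
        · exact Or.inl (Or.inl ⟨hzA, h⟩)
        · exact Or.inr ⟨hzA, h⟩
      · exact Or.inl (Or.inr hzB)
    obtain ⟨z, hzK, hz1, hzA, hzE'⟩ := hK _ _ ((hA.inter hE).union hB) (hA.inter hE') h1
      (by obtain ⟨z, ⟨hzK, hzA⟩, hzE⟩ := hne; exact ⟨z, hzK, Or.inl ⟨hzA, hzE⟩⟩)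
      (by obtain ⟨z, ⟨hzK, hzA⟩, hzE'⟩ := hne'; exact ⟨z, hzK, hzA, hzE'⟩)
    have hzE : z ∈ E := by
      rcases hz1 with ⟨-, h⟩ | hzB
      · exact h
      · exact hBE z ⟨⟨hzK, hzA⟩, hzB⟩
    have : z ∈ K ∩ A ∩ (E ∩ E') := ⟨⟨hzK, hzA⟩, hzE, hzE'⟩
    rw [hempty] at this
    exact this
  by_cases hxB : ∀ z ∈ K ∩ A ∩ B, z ∈ C
  · exact key hC hC' hcov hxC hyC' hempty hxB
  · push Not at hxB
    obtain ⟨z₀, hz₀, hz₀C⟩ := hxB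
    have hz₀C' : z₀ ∈ C' := (hcov hz₀.1).resolve_left hz₀C
    refine key hC' hC (fun z hz => (hcov hz).symm) hyC' hxC (by rwa [Set.inter_comm C' C])
      fun z hz => ?_
    rwa [hAB hz hz₀]

/-- The initial point of a non-degenerate segment does not lie between an interior point of the
segment and the final point. -/
theorem left_notMem_segment_of_mem_openSegment {q q' m : ℂ} (hne : q ≠ q')
    (hm : m ∈ openSegment ℝ q q') : q ∉ segment ℝ m q' := by
  intro hq
  obtain ⟨a, b, ha, hb, hab, rfl⟩ := hm
  obtain ⟨c, d, hc, hd, hcd, hq⟩ := hq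
  simp only [Complex.real_smul] at hq
  have hab' : (a : ℂ) + b = 1 := by exact_mod_cast hab
  have hcd' : (c : ℂ) + d = 1 := by exact_mod_cast hcd
  have h1 : ((c * b + d : ℝ) : ℂ) * (q' - q) = 0 := by
    push_cast
    linear_combination hq - q * hcd' - q * c * hab'
  have hpos : 0 < c * b + d := by
    have hc' : c = 1 - d := by linarith
    rw [hc']
    nlinarith [mul_nonneg hd (sub_nonneg.2 (by linarith : b ≤ 1))]
  rcases mul_eq_zero.1 h1 with h | h
  · exact hpos.ne' (by exact_mod_cast h)
  · exact hne (sub_eq_zero.1 h).symm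

/-! ## Trimming a crossing along a cut through an edge -/

/-- **Trimming a crossing.**  Let `K` be a crossing of `Q` inside `X ∪ [q, q']` (`X` closed,
meeting `[q, q']` at most in `{q, q'}`, `[q, q']` off `∂₀Q ∪ ∂₂Q`), and let `[Q] ⊆ cl₁ ∪ cl₂`
with `cl₁, cl₂` closed, `cl₁ ∩ cl₂ ⊆ β`, `K ∩ β ⊆ {m}` for an interior point `m` of `[q, q']`,
`[q, q'] ∩ cl₂ ⊆ [m, q']`, and `∂₀Q ∪ ∂₂Q` off `cl₁`.  Then `Q` has a crossing inside `X`
(namely `K ∩ cl₂ ∩ X`). -/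
theorem isCrossing_trim (Q : Quad D) {K X cl₁ cl₂ β : Set ℂ} {q q' m : ℂ}
    (hK : Q.IsCrossing K) (hKX : K ⊆ X ∪ segment ℝ q q') (hX : IsClosed X)
    (hcl₁ : IsClosed cl₁) (hcl₂ : IsClosed cl₂) (hcov : Q.carrier ⊆ cl₁ ∪ cl₂)
    (hinter : cl₁ ∩ cl₂ ⊆ β) (hKβ : K ∩ β ⊆ {m}) (hne : q ≠ q') (hm : m ∈ openSegment ℝ q q')
    (hseg₂ : segment ℝ q q' ∩ cl₂ ⊆ segment ℝ m q') (hXseg : X ∩ segment ℝ q q' ⊆ {q, q'})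
    (h02 : Disjoint (segment ℝ q q') (Q.side 0 ∪ Q.side 2))
    (hp : ∀ z ∈ Q.side 0 ∪ Q.side 2, z ∉ cl₁) :
    ∃ K', Q.IsCrossing K' ∧ K' ⊆ X := by
  obtain ⟨hKc, hKconn, hKQ, ⟨p0, hp0K, hp0⟩, ⟨p2, hp2K, hp2⟩⟩ := hK
  -- step 1: the part of `K` on the side `cl₂` of the cut is connected and meets both sides
  have h2pre : IsPreconnected (K ∩ cl₂) := by
    refine isPreconnected_inter_of_subsingleton hKconn.isPreconnected
      (fun z hz => (hcov (hKQ hz)).symm) hcl₂ hcl₁ ((Set.subsingleton_singleton (a := m)).anti ?_)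
    rintro z ⟨⟨hzK, hz₂⟩, hz₁⟩
    exact hKβ ⟨hzK, hinter ⟨hz₁, hz₂⟩⟩
  have hmem₂ : ∀ z ∈ K, z ∈ Q.side 0 ∪ Q.side 2 → z ∈ K ∩ cl₂ := fun z hzK hz =>
    ⟨hzK, (hcov (hKQ hzK)).resolve_left (hp z hz)⟩
  have hmemX : ∀ z ∈ K, z ∈ Q.side 0 ∪ Q.side 2 → z ∈ X := fun z hzK hz =>
    (hKX hzK).resolve_right fun h => Set.disjoint_left.1 h02 h hz
  have hK₂X : K ∩ cl₂ ⊆ X ∪ segment ℝ m q' := by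
    rintro z ⟨hzK, hz₂⟩
    rcases hKX hzK with h | h
    · exact Or.inl h
    · exact Or.inr (hseg₂ ⟨h, hz₂⟩)
  -- step 2: remove the dangling half-open half-edge `[m, q')`
  have hsegc : IsClosed (segment ℝ m q') := by
    rw [segment_eq_image_lineMap]
    exact (isCompact_Icc.image AffineMap.lineMap_continuous).isClosed
  have hq : q ∉ segment ℝ m q' := left_notMem_segment_of_mem_openSegment hne hm
  have hsub : segment ℝ m q' ⊆ segment ℝ q q' :=
    (convex_segment q q').segment_subset (openSegment_subset_segment ℝ q q' hm)
      (right_mem_segment ℝ q q')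
  have h3pre : IsPreconnected (K ∩ cl₂ ∩ X) := by
    refine isPreconnected_inter_of_subsingleton h2pre hK₂X hX hsegc
      ((Set.subsingleton_singleton (a := q')).anti ?_)
    rintro z ⟨⟨-, hzX⟩, hzs⟩
    rcases hXseg ⟨hzX, hsub hzs⟩ with h | h
    · exact absurd (h ▸ hzs) hq
    · exact h
  refine ⟨K ∩ cl₂ ∩ X, ⟨(hKc.inter_right hcl₂).inter_right hX,
    ⟨⟨p0, hmem₂ p0 hp0K (Or.inl hp0), hmemX p0 hp0K (Or.inl hp0)⟩, h3pre⟩,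
    fun z hz => hKQ hz.1.1, ⟨p0, ⟨hmem₂ p0 hp0K (Or.inl hp0), hmemX p0 hp0K (Or.inl hp0)⟩, hp0⟩,
    ⟨p2, ⟨hmem₂ p2 hp2K (Or.inr hp2), hmemX p2 hp2K (Or.inr hp2)⟩, hp2⟩⟩, fun z hz => hz.2⟩

/-- **The half-edge inside the pocket.**  If the segment `[q, q']` lies in `cl₁ ∪ cl₂`
(closed, `cl₁ ∩ cl₂ ⊆ β`), meets `β` at most at its interior point `m`, and the points of a
ball around `m` strictly on the `q`-side of the hyperplane through `m` perpendicular to the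
segment lie in `U₁ ⊆ cl₁`, then the only points of `[q, q']` in `cl₂` are on `[m, q']`
(the half-open piece `[q, m)` is connected, off `β`, and touches `U₁`). -/
theorem segment_inter_subset_of_side {U₁ cl₁ cl₂ β : Set ℂ} {q q' m : ℂ} {ρ : ℝ} (hne : q ≠ q')
    (hcov : segment ℝ q q' ⊆ cl₁ ∪ cl₂) (hcl₁ : IsClosed cl₁) (hcl₂ : IsClosed cl₂)
    (hU₁ : U₁ ⊆ cl₁) (hinter : cl₁ ∩ cl₂ ⊆ β) (hsegβ : segment ℝ q q' ∩ β ⊆ {m})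
    (hm : m ∈ openSegment ℝ q q') (hρ : 0 < ρ)
    (hP : Metric.ball m ρ ∩ {z | inner ℝ (z - m) (q' - q) < 0} ⊆ U₁) :
    segment ℝ q q' ∩ cl₂ ⊆ segment ℝ m q' := by
  rw [openSegment_eq_image_lineMap] at hm
  obtain ⟨t₀, ⟨ht₀0, ht₀1⟩, rfl⟩ := hm
  set γ : ℝ → ℂ := fun s => AffineMap.lineMap q q' s with hγ
  have hγs : ∀ s, γ s = (s : ℂ) * (q' - q) + q := fun s => by
    simp only [hγ, AffineMap.lineMap_apply_module', Complex.real_smul]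
  rintro z ⟨hz, hz₂⟩
  rw [segment_eq_image_lineMap] at hz
  obtain ⟨tz, ⟨htz0, htz1⟩, rfl⟩ := hz
  change γ tz ∈ segment ℝ (γ t₀) q'
  rcases le_or_gt t₀ tz with hle | hlt
  · -- beyond `m`: on `[m, q']`
    rw [segment_eq_image_lineMap]
    refine ⟨(tz - t₀) / (1 - t₀), ⟨div_nonneg (by linarith) (by linarith),
      (div_le_one (by linarith)).2 (by linarith)⟩, ?_⟩
    rw [AffineMap.lineMap_apply_module', Complex.real_smul, hγs, hγs]
    have h1 : (1 : ℂ) - (t₀ : ℂ) ≠ 0 := by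
      rw [sub_ne_zero]
      exact_mod_cast (ne_of_gt ht₀1)
    push_cast
    field_simp
    ring
  · -- before `m`: the piece `γ [tz, t₀)` is connected, off `β`, meets `cl₂` at `γ tz` and
    -- `U₁` near `m` — contradiction with `cl₁ ∩ cl₂ ⊆ β`
    exfalso
    set A : Set ℂ := γ '' Ico tz t₀ with hA
    have hAseg : A ⊆ segment ℝ q q' := by
      rw [segment_eq_image_lineMap]
      exact image_mono (Ico_subset_Icc_self.trans (Icc_subset_Icc htz0 ht₀1.le))
    have hAβ : ∀ w ∈ A, w ∉ β := by
      rintro _ ⟨s, hs, rfl⟩ hw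
      have h1 : γ s = γ t₀ := hsegβ ⟨hAseg ⟨s, hs, rfl⟩, hw⟩
      have h2 : s = t₀ := AffineMap.lineMap_injective ℝ hne h1
      linarith [hs.2]
    have hApre : IsPreconnected A :=
      isPreconnected_Ico.image γ AffineMap.lineMap_continuous.continuousOn
    -- a point of `A` near `m`, on the `q`-side
    have hqq : 0 < ‖q' - q‖ := norm_pos_iff.2 (sub_ne_zero.2 hne.symm)
    set ε : ℝ := min (t₀ - tz) (ρ / (2 * ‖q' - q‖)) with hε
    have hε0 : 0 < ε := lt_min (by linarith) (by positivity)
    have hε1 : ε ≤ t₀ - tz := min_le_left _ _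
    have hε2 : ε * ‖q' - q‖ < ρ := by
      have h := min_le_right (t₀ - tz) (ρ / (2 * ‖q' - q‖))
      rw [← hε] at h
      have h' : ε * ‖q' - q‖ ≤ ρ / 2 := by
        calc ε * ‖q' - q‖ ≤ ρ / (2 * ‖q' - q‖) * ‖q' - q‖ := by gcongr
          _ = ρ / 2 := by field_simp
      linarith
    have hs₁ : t₀ - ε ∈ Ico tz t₀ := ⟨by linarith, by linarith⟩
    have hw₁ : γ (t₀ - ε) - γ t₀ = (-ε : ℝ) • (q' - q) := by
      rw [hγs, hγs, Complex.real_smul]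
      push_cast
      ring
    have hw₁U : γ (t₀ - ε) ∈ U₁ := by
      refine hP ⟨?_, ?_⟩
      · rw [Metric.mem_ball, dist_eq_norm, hw₁, norm_smul, Real.norm_eq_abs, abs_neg,
          abs_of_pos hε0]
        exact hε2
      · show inner ℝ (γ (t₀ - ε) - γ t₀) (q' - q) < 0
        rw [hw₁, real_inner_smul_left, real_inner_self_eq_norm_sq]
        nlinarith [sq_pos_of_pos hqq]
    obtain ⟨w, hwA, hw₁', hw₂'⟩ := isPreconnected_closed_iff.1 hApre cl₁ cl₂ hcl₁ hcl₂
      (hAseg.trans hcov) ⟨γ (t₀ - ε), ⟨t₀ - ε, hs₁, rfl⟩, hU₁ hw₁U⟩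
      ⟨γ tz, ⟨tz, ⟨le_rfl, hlt⟩, rfl⟩, hz₂⟩
    exact hAβ w hwA (hinter ⟨hw₁', hw₂'⟩)

/-! ## The two closed sides of a cross-cut cover the closed domain -/

/-- For Newman's two sides `U₁, U₂` of a cross-cut `L` of a Jordan domain `J` (from
`J.boundary s` to `J.boundary t`, `s < t < s + 1`): `closure J ⊆ cl U₁ ∪ cl U₂` and
`cl U₁ ∩ cl U₂ ⊆ L`. -/
theorem crosscut_closure_cover : ∀ (J : Literature.Probability.RandomPlanarGeometry.JordanDomain) (L U₁ U₂ : Set ℂ) (s t : ℝ), s < t → t < s + 1 → J.IsCrosscut L (J.boundary s) (J.boundary t) → IsOpen U₁ → IsOpen U₂ → Disjoint U₁ U₂ → U₁ ∪ U₂ = J.carrier \ L → frontier U₁ = L ∪ J.boundary '' Set.Icc s t → frontier U₂ = L ∪ J.boundary '' Set.Icc t (s + 1) → closure J.carrier ⊆ closure U₁ ∪ closure U₂ ∧ closure U₁ ∩ closure U₂ ⊆ L := by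
  -- adapted from `JordanDomain.inter_nonempty_of_crosscut`
  -- (Literature/Topology/PlaneTopology/Crosscut.lean)
  intro J L U₁ U₂ s t hst hts hL h₁o h₂o hdisj hunion hf₁ hf₂
  obtain ⟨hLarc, -, -, -, -⟩ := hL
  have haL : J.boundary s ∈ L := hLarc.left_mem
  have hbL : J.boundary t ∈ L := hLarc.right_mem
  have hU₁D : U₁ ⊆ J.carrier := fun z hz => ((hunion ▸ Or.inl hz : z ∈ J.carrier \ L)).1
  have hU₂D : U₂ ⊆ J.carrier := fun z hz => ((hunion ▸ Or.inr hz : z ∈ J.carrier \ L)).1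
  refine ⟨fun z hz => ?_, fun z ⟨hz₁, hz₂⟩ => ?_⟩
  · rw [closure_eq_self_union_frontier] at hz
    rcases hz with hz | hz
    · by_cases hzL : z ∈ L
      · exact Or.inl (by rw [closure_eq_self_union_frontier, hf₁]; exact Or.inr (Or.inl hzL))
      · have : z ∈ U₁ ∪ U₂ := by rw [hunion]; exact ⟨hz, hzL⟩
        exact this.imp (fun h => subset_closure h) (fun h => subset_closure h)
    · rw [← J.range_boundary] at hz
      obtain ⟨v, rfl⟩ := hz
      obtain ⟨w, hw, hwv⟩ := J.periodic_boundary.exists_mem_Ico one_pos v s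
      rw [hwv]
      rcases le_or_gt w t with hwt | hwt
      · left
        rw [closure_eq_self_union_frontier, hf₁]
        exact Or.inr (Or.inr ⟨w, ⟨hw.1, hwt⟩, rfl⟩)
      · right
        rw [closure_eq_self_union_frontier, hf₂]
        exact Or.inr (Or.inr ⟨w, ⟨hwt.le, hw.2.le⟩, rfl⟩)
  · by_contra hzL
    have hzU₁ : z ∉ U₁ := fun hz => Set.disjoint_left.1 (hdisj.closure_right h₁o) hz hz₂
    have hzU₂ : z ∉ U₂ := fun hz => Set.disjoint_left.1 (hdisj.symm.closure_right h₂o) hz hz₁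
    rw [closure_eq_self_union_frontier, hf₁] at hz₁
    rw [closure_eq_self_union_frontier, hf₂] at hz₂
    have hz₁' : z ∈ J.boundary '' Icc s t := by
      rcases hz₁ with h | h | h
      · exact absurd h hzU₁
      · exact absurd h hzL
      · exact h
    have hz₂' : z ∈ J.boundary '' Icc t (s + 1) := by
      rcases hz₂ with h | h | h
      · exact absurd h hzU₂
      · exact absurd h hzL
      · exact h
    obtain ⟨w₁, hw₁, hw₁z⟩ := hz₁'
    obtain ⟨w₂, hw₂, hw₂z⟩ := hz₂'
    rcases hw₂.2.lt_or_eq with hlt | heq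
    · have hw : w₁ = w₂ := J.injOn_boundary_Ico s ⟨hw₁.1, by linarith [hw₁.2]⟩
        ⟨by linarith [hw₂.1], hlt⟩ (hw₁z.trans hw₂z.symm)
      have hwt : w₁ = t := le_antisymm hw₁.2 (hw ▸ hw₂.1)
      exact hzL (by rw [← hw₁z, hwt]; exact hbL)
    · exact hzL (by rw [← hw₂z, heq, J.periodic_boundary]; exact haL)

end Summit.CriticalPhenomena.CardyFormulaZ2.Theorems.CardySelfRefinement

end
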